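import Summits.KontsevichZagierPeriods.KontsevichZagierPeriods.Theorems.LinRedNormalFormArrangementNormalFormStubRebaseSimpleZeroManyChainTools

/-!
# Stub `stub_rebaseSimpleZeroMany`, part `rebaseSimpleZeroMany_common` (crux `ArrangementNormalForm`,
line `janus-bands`) — brick `ChainBlocks`

BLOCK DOMAINS of `n + 1` fibres over a one-dimensional base: the chain `t₀ < t₁ < ⋯ < tₙ` cut at
a set `c` of links into consecutive blocks, the first fibre of every block bounded below by an
affine form `U`, the last fibre of every block bounded above by an affine form `V`
(`RebaseChain.blo/bhi`, membership `RebaseChain.mem_bdom`; the clean chain is `c = ∅`). These are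
the cells of the dissections of a clean chain (position of a section among the fibres; the
sub-section Janus expansion). Goodness: `RebaseChain.good_linkedPivots` (any number of fibres and
links: one joint affine pull-back lands literally in `GG B 2 K` as soon as every linked component
has ONE letter-transverse affine bound, its pivot) and its block instance `RebaseChain.good_bdom`.
Registered: `rebaseSimpleZeroMany_linkedPivots`.

References: M. Kontsevich, D. Zagier, *Periods* (2001), §1.2, rules (1a), (2).
-/

noncomputable section

open Set MeasureTheory MvPolynomial
open Literature.NumberTheory.Transcendental Literature.ModelTheory.ExponentialFields

namespace Summit.KontsevichZagierPeriods.ArrangementNormalForm.JanusBands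

namespace RebaseChain

open SeparatePos RebasePos RebaseZero RebaseNest

/-! ### One pivot per linked component -/

section Pivots

variable {B K m m' : ℕ}

/-- **One pivot per linked component.** If all letters have `y`-slope `λ`, `P` assigns to every
fibre a form, linked fibres getting the same form, and every affine bound of the fibre `l` is
`P l` or `λ`-parallel, then the representation is good for `GG B 2 K`: one joint affine pull-back
(shear along `λ`, rescale the pivot of each component to the coordinate `y` itself).
[Kontsevich–Zagier 2001, §1.2, rule (2)] -/
theorem good_linkedPivots {n₁ n₂ : ℕ} (s : KZ.IntegralRep (B + 1 + K))
    (M : Fin m' → (Fin (B + 1) → ℚ) × ℚ) (L : Fin m → (Fin B → ℚ) × ℚ) (e : Fin m → ℕ)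
    (p : MvPolynomial (Fin B) ℚ) (ℓ₁ ℓ₂ : (Fin B → ℚ) × ℚ)
    (a : Fin K → Option ((Fin (B + 1) → ℚ) × ℚ)) (lo hi : Fin K → Fin K ⊕ ((Fin (B + 1) → ℚ) × ℚ))
    (h12 : n₁ = 0 ∨ n₂ = 0) (hbd : Bornology.IsBounded s.domain) (hdom : s.domain = gDom B K m' M lo hi)
    (hint : EqOn s.integrand (glit B K p L e ℓ₁ ℓ₂ n₁ n₂ a) s.domain) (P : Fin K → (Fin (B + 1) → ℚ) × ℚ)
    (lam : ℚ) (hA : ∀ l c, a l = some c → c.1 (Fin.last B) = lam)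
    (hlinkP : ∀ l l', (lo l = Sum.inl l' ∨ hi l = Sum.inl l') → P l = P l')
    (hB : ∀ l c, (lo l = Sum.inr c ∨ hi l = Sum.inr c) → c = P l ∨ c.1 (Fin.last B) = lam) :
    ∃ c ∈ AddSubgroup.closure (GGset B 2 K), KZ.of s - c ∈ KZ.relations := by
  classical
  refine good_of_pull s M L e p ℓ₁ ℓ₂ a lo hi h12 hbd hdom hint
    (fun l => if (P l).1 (Fin.last B) = lam then 1 else (P l).1 (Fin.last B) - lam) (fun _ => lam)
    (fun l => if (P l).1 (Fin.last B) = lam then 0 else (fun q => (P l).1 (Fin.castSucc q), (P l).2))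
    (fun l => ?_) (fun l l' h => ?_) hA fun l c hc => ?_
  · split_ifs with h
    exacts [one_ne_zero, sub_ne_zero.2 h]
  · have hP := hlinkP l l' h
    refine ⟨?_, rfl, ?_⟩ <;> simp only [hP]
  · rcases hB l c hc with rfl | h
    · by_cases hP : (P l).1 (Fin.last B) = lam
      · rw [if_pos hP, if_pos hP]
        exact Or.inl (piv_par _ _ _ _ hP)
      · rw [if_neg hP, if_neg hP]
        exact Or.inr (pullC_eq_single _ _ (sub_ne_zero.2 hP) _ rfl)
    · exact Or.inl (piv_par _ _ _ _ h)

end Pivots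

/-! ### Block domains -/

variable {n m' : ℕ}

/-- Lower bounds of the BLOCK DOMAIN with cut links `c`: the first fibre of a block (the fibre
`0`, or `j + 1` for a cut link `j`) is bounded below by the form `U`, the other fibres by the
previous fibre. -/
def blo (c : Finset ℕ) (U : Fin (n + 1) → Cf) : Fin (n + 1) → Fin (n + 1) ⊕ Cf :=
  Fin.cases (Sum.inr (U 0)) fun j => if (j : ℕ) ∈ c then Sum.inr (U j.succ) else Sum.inl j.castSucc

/-- Upper bounds of the BLOCK DOMAIN with cut links `c`: the last fibre of a block (the fibre
`n`, or `j` for a cut link `j`) is bounded above by the form `V`, the other fibres by the next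
fibre. -/
def bhi (c : Finset ℕ) (V : Fin (n + 1) → Cf) : Fin (n + 1) → Fin (n + 1) ⊕ Cf := fun i =>
  Fin.lastCases (Sum.inr (V (Fin.last n)))
    (fun j => if (j : ℕ) ∈ c then Sum.inr (V j.castSucc) else Sum.inl j.succ) i

/-- The lower bound of the first fibre. -/
@[simp] theorem blo_zero (c : Finset ℕ) (U : Fin (n + 1) → Cf) : blo c U 0 = Sum.inr (U 0) := rfl

/-- The lower bound of a later fibre. -/
theorem blo_succ (c : Finset ℕ) (U : Fin (n + 1) → Cf) (j : Fin n) :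
    blo c U j.succ = if (j : ℕ) ∈ c then Sum.inr (U j.succ) else Sum.inl j.castSucc := rfl

/-- The upper bound of the last fibre. -/
@[simp] theorem bhi_last (c : Finset ℕ) (V : Fin (n + 1) → Cf) :
    bhi c V (Fin.last n) = Sum.inr (V (Fin.last n)) := Fin.lastCases_last

/-- The upper bound of an earlier fibre. -/
theorem bhi_castSucc (c : Finset ℕ) (V : Fin (n + 1) → Cf) (j : Fin n) :
    bhi c V j.castSucc = if (j : ℕ) ∈ c then Sum.inr (V j.castSucc) else Sum.inl j.succ :=
  Fin.lastCases_castSucc j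

/-- The clean chain is the block domain without cuts. -/
theorem clo_eq_blo (A : Cf) : clo (n := n) A = blo ∅ fun _ => A := by
  refine funext fun l => ?_
  induction l using Fin.cases with
  | zero => rfl
  | succ j => rw [clo_succ, blo_succ, if_neg (Finset.notMem_empty _)]

/-- The clean chain is the block domain without cuts. -/
theorem chi_eq_bhi (Bd : Cf) : chi (n := n) Bd = bhi ∅ fun _ => Bd := by
  refine funext fun l => ?_
  induction l using Fin.lastCases with
  | last => rw [chi_last, bhi_last]
  | cast j => rw [chi_castSucc, bhi_castSucc, if_neg (Finset.notMem_empty _)]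

/-- An affine lower bound of a block domain is a value of `U`. -/
theorem blo_eq_inr {c : Finset ℕ} {U : Fin (n + 1) → Cf} {l : Fin (n + 1)} {d : Cf}
    (h : blo c U l = Sum.inr d) : d = U l := by
  induction l using Fin.cases with
  | zero => rw [blo_zero] at h; cases h; rfl
  | succ j =>
    rw [blo_succ] at h
    split_ifs at h
    cases h; rfl

/-- An affine upper bound of a block domain is a value of `V`. -/
theorem bhi_eq_inr {c : Finset ℕ} {V : Fin (n + 1) → Cf} {l : Fin (n + 1)} {d : Cf}
    (h : bhi c V l = Sum.inr d) : d = V l := by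
  induction l using Fin.lastCases with
  | last => rw [bhi_last] at h; cases h; rfl
  | cast j =>
    rw [bhi_castSucc] at h
    split_ifs at h
    cases h; rfl

/-- A fibre lower bound of a block domain is an uncut link. -/
theorem blo_eq_inl {c : Finset ℕ} {U : Fin (n + 1) → Cf} {l l' : Fin (n + 1)}
    (h : blo c U l = Sum.inl l') : ∃ j : Fin n, (j : ℕ) ∉ c ∧ l = j.succ ∧ l' = j.castSucc := by
  induction l using Fin.cases with
  | zero => rw [blo_zero] at h; cases h
  | succ j =>
    rw [blo_succ] at h
    split_ifs at h with hj
    cases h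
    exact ⟨j, hj, rfl, rfl⟩

/-- A fibre upper bound of a block domain is an uncut link. -/
theorem bhi_eq_inl {c : Finset ℕ} {V : Fin (n + 1) → Cf} {l l' : Fin (n + 1)}
    (h : bhi c V l = Sum.inl l') : ∃ j : Fin n, (j : ℕ) ∉ c ∧ l = j.castSucc ∧ l' = j.succ := by
  induction l using Fin.lastCases with
  | last => rw [bhi_last] at h; cases h
  | cast j =>
    rw [bhi_castSucc] at h
    split_ifs at h with hj
    cases h
    exact ⟨j, hj, rfl, rfl⟩

/-- **Membership in a block domain**: `y ∈ cell M`, `U₀ < t₀`, `tₙ < Vₙ`, and for every link `j`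
either the two affine comparisons `tⱼ < Vⱼ`, `Uⱼ₊₁ < tⱼ₊₁` (cut link) or `tⱼ < tⱼ₊₁` (uncut link). -/
theorem mem_bdom (M : Fin m' → Cf) (c : Finset ℕ) (U V : Fin (n + 1) → Cf) (z : Fin (0 + 1 + (n + 1)) → ℝ) :
    z ∈ gDom 0 (n + 1) m' M (blo c U) (bhi c V) ↔
      yv z ∈ cell M ∧ ev (U 0) (yv z) < tv z 0 ∧ tv z (Fin.last n) < ev (V (Fin.last n)) (yv z) ∧
      ∀ j : Fin n, ((j : ℕ) ∈ c → tv z j.castSucc < ev (V j.castSucc) (yv z) ∧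
          ev (U j.succ) (yv z) < tv z j.succ) ∧ ((j : ℕ) ∉ c → tv z j.castSucc < tv z j.succ) := by
  rw [mem_gDom_iff, forall_and, Fin.forall_fin_succ, Fin.forall_fin_succ']
  simp only [blo_zero, blo_succ, bhi_last, bhi_castSucc, RebaseZero.pv_inr]
  constructor
  · rintro ⟨hy, ⟨h0, hl⟩, hu, hn⟩
    refine ⟨hy, h0, hn, fun j => ⟨fun hj => ⟨?_, ?_⟩, fun hj => ?_⟩⟩
    · have := hu j; rwa [if_pos hj, RebaseZero.pv_inr] at this
    · have := hl j; rwa [if_pos hj, RebaseZero.pv_inr] at this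
    · have := hu j; rwa [if_neg hj, RebaseZero.pv_inl] at this
  · rintro ⟨hy, h0, hn, h⟩
    refine ⟨hy, ⟨h0, fun j => ?_⟩, fun j => ?_, hn⟩
    · by_cases hj : (j : ℕ) ∈ c
      · rw [if_pos hj, RebaseZero.pv_inr]; exact ((h j).1 hj).2
      · rw [if_neg hj, RebaseZero.pv_inl]; exact (h j).2 hj
    · by_cases hj : (j : ℕ) ∈ c
      · rw [if_pos hj, RebaseZero.pv_inr]; exact ((h j).1 hj).1
      · rw [if_neg hj, RebaseZero.pv_inl]; exact (h j).2 hj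

/-- **Lower barrier.** In a block domain every fibre lies above a common lower barrier of the
forms `U`. -/
theorem barrier_lo {M : Fin m' → Cf} {c : Finset ℕ} {U V : Fin (n + 1) → Cf}
    {z : Fin (0 + 1 + (n + 1)) → ℝ} (hz : z ∈ gDom 0 (n + 1) m' M (blo c U) (bhi c V)) {T₀ : ℝ}
    (hU : ∀ l, T₀ ≤ ev (U l) (yv z)) (l : Fin (n + 1)) : T₀ < tv z l := by
  obtain ⟨-, h0, -, h⟩ := (mem_bdom M c U V z).1 hz
  induction l using Fin.induction with
  | zero => exact (hU 0).trans_lt h0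
  | succ j ih =>
    by_cases hj : (j : ℕ) ∈ c
    · exact (hU _).trans_lt ((h j).1 hj).2
    · exact ih.trans ((h j).2 hj)

/-- **Upper barrier.** In a block domain every fibre lies below a common upper barrier of the
forms `V`. -/
theorem barrier_hi {M : Fin m' → Cf} {c : Finset ℕ} {U V : Fin (n + 1) → Cf}
    {z : Fin (0 + 1 + (n + 1)) → ℝ} (hz : z ∈ gDom 0 (n + 1) m' M (blo c U) (bhi c V)) {B₀ : ℝ}
    (hV : ∀ l, ev (V l) (yv z) ≤ B₀) (l : Fin (n + 1)) : tv z l < B₀ := by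
  obtain ⟨-, -, hn, h⟩ := (mem_bdom M c U V z).1 hz
  induction l using Fin.reverseInduction with
  | last => exact hn.trans_le (hV _)
  | cast j ih =>
    by_cases hj : (j : ℕ) ∈ c
    · exact ((h j).1 hj).1.trans_le (hV _)
    · exact ((h j).2 hj).trans ih

/-- **Monotonicity on an uncut range.** If no link `j` with `u ≤ j < v` is cut, the fibres are
strictly increasing on `[u, v]`. -/
theorem lt_of_uncut {M : Fin m' → Cf} {c : Finset ℕ} {U V : Fin (n + 1) → Cf}
    {z : Fin (0 + 1 + (n + 1)) → ℝ} (hz : z ∈ gDom 0 (n + 1) m' M (blo c U) (bhi c V)) {u v : Fin (n + 1)}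
    (hc : ∀ j : ℕ, (u : ℕ) ≤ j → j < v → j ∉ c) {i i' : Fin (n + 1)} (hu : u ≤ i) (hii' : i < i')
    (hv : i' ≤ v) : tv z i < tv z i' := by
  obtain ⟨-, -, -, h⟩ := (mem_bdom M c U V z).1 hz
  refine lt_of_links (tv z) (u := u) (v := v) (fun j hju hjv => (h j).2 (hc j ?_ ?_)) hu hii' hv
  · exact Fin.le_def.1 hju
  · have := Fin.le_def.1 hjv; rw [Fin.val_succ] at this; omega

/-! ### Goodness of block domains -/

variable {s : KZ.IntegralRep (0 + 1 + (n + 1))} {M : Fin m' → Cf} {T : BData}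
  {p : MvPolynomial (Fin 0) ℚ} {a : Fin (n + 1) → Option Cf}

/-- **Block domains with one pivot per block are good.** A representation on a block domain with
the literal integrand (constant letters, `n₁ = 0 ∨ n₂ = 0`, bounded domain) is good for
`GG 0 2 (n + 1)` as soon as forms `P l`, equal along uncut links, are given such that every `U l`
and every `V l` is `P l` or constant. [Kontsevich–Zagier 2001, §1.2, rule (2)] -/
theorem good_bdom (c : Finset ℕ) (U V : Fin (n + 1) → Cf) (h12 : T.n₁ = 0 ∨ T.n₂ = 0)
    (hbd : Bornology.IsBounded s.domain) (hdom : s.domain = gDom 0 (n + 1) m' M (blo c U) (bhi c V))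
    (hint : EqOn s.integrand (glitB T p a) s.domain) (ha0 : ∀ l d, a l = some d → d.1 (Fin.last 0) = 0)
    (P : Fin (n + 1) → Cf) (hP : ∀ j : Fin n, (j : ℕ) ∉ c → P j.castSucc = P j.succ)
    (hU : ∀ l, U l = P l ∨ (U l).1 (Fin.last 0) = 0) (hV : ∀ l, V l = P l ∨ (V l).1 (Fin.last 0) = 0) :
    Good (n + 1) (KZ.of s) := by
  refine good_linkedPivots s M T.L T.e p T.ℓ₁ T.ℓ₂ a (blo c U) (bhi c V) h12 hbd hdom hint P 0 ha0
    (fun l l' hl => ?_) fun l d hd => ?_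
  · rcases hl with hl | hl
    · obtain ⟨j, hj, rfl, rfl⟩ := blo_eq_inl hl
      exact (hP j hj).symm
    · obtain ⟨j, hj, rfl, rfl⟩ := bhi_eq_inl hl
      exact hP j hj
  · rcases hd with hd | hd
    · rw [blo_eq_inr hd]; exact hU l
    · rw [bhi_eq_inr hd]; exact hV l

end RebaseChain

/-- Registered support goal of this file (part of `rebaseSimpleZeroMany_common`): one pivot per
linked component suffices for `GG B 2 K` (`RebaseChain.good_linkedPivots`). -/
theorem rebaseSimpleZeroMany_linkedPivots (B K m m' n₁ n₂ : ℕ) (s : KZ.IntegralRep (B + 1 + K)) (M : Fin m' → (Fin (B + 1) → ℚ) × ℚ) (L : Fin m → (Fin B → ℚ) × ℚ) (e : Fin m → ℕ) (p : MvPolynomial (Fin B) ℚ) (ℓ₁ ℓ₂ : (Fin B → ℚ) × ℚ) (a : Fin K → Option ((Fin (B + 1) → ℚ) × ℚ)) (lo hi : Fin K → Fin K ⊕ ((Fin (B + 1) → ℚ) × ℚ)) (h12 : n₁ = 0 ∨ n₂ = 0) (hbd : Bornology.IsBounded s.domain) (hdom : s.domain = SeparatePos.gDom B K m' M lo hi)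 (hint : EqOn s.integrand (RebasePos.glit B K p L e ℓ₁ ℓ₂ n₁ n₂ a) s.domain) (P : Fin K → (Fin (B + 1) → ℚ) × ℚ) (lam : ℚ) (hA : ∀ l c, a l = some c → c.1 (Fin.last B) = lam) (hlinkP : ∀ l l', (lo l = Sum.inl l' ∨ hi l = Sum.inl l') → P l = P l') (hB : ∀ l c, (lo l = Sum.inr c ∨ hi l = Sum.inr c) → c = P l ∨ c.1 (Fin.last B) = lam) : ∃ c ∈ AddSubgroup.closure (SeparatePos.GGset B 2 K), KZ.of s - c ∈ KZ.relations :=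
  RebaseChain.good_linkedPivots s M L e p ℓ₁ ℓ₂ a lo hi h12 hbd hdom hint P lam hA hlinkP hB

end Summit.KontsevichZagierPeriods.ArrangementNormalForm.JanusBands
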